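import Summits.ABC.IUTFork.DAGL2s
import Summits.ABC.IUTFork.DAGL4s
import Summits.ABC.IUTFork.DAGXc
import Summits.ABC.IUTFork.DAGXi

/-!
# Kernel DAG index — witness UPGRADE part o (GENERATED by abc-iut-c312-2 gen 5 `work/gen_index.py upgrade` @2026-08-26T19:27Z from HOME/plan/DAG.tsv
(regenerated 2026-08-26T19:24:29Z); spec v1.3 §2(c) "`_holds` iff the DAG row is discharged", §5 "re-file when nodes change status")

THIS FILE PROVES NOTHING NEW AND ASSERTS NOTHING. For 4 nodes ALREADY INDEXED with a partial witness `N_<id>_part` (their DAG row was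
`landed(p…)` when indexed) whose row is NOW `discharged(p…)`, it adds the discharge witness `N_<id>_holds : N_<id> := N_<id>_part` BY NAME —
the node statement `N_<id>` is untouched (append-only across files: nothing landed is redefined). Nothing here says abc is proved or refuted
or takes a side on [IUTchIII] Cor 3.12. typed ≠ discharged; indexed ≠ endorsed.
-/

namespace Summit.ABC.IUTFork.DAG

/-- [node EtTh:Cor2.8(ii) · L2/D1 · DAG status discharged(p441545)] discharge witness of `N_EtTh_Cor2_8_ii` (indexed in `DAGXc` with `_part` while the row was landed; now discharged, p441545): BY NAME; proves nothing new. -/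
theorem N_EtTh_Cor2_8_ii_holds : N_EtTh_Cor2_8_ii := N_EtTh_Cor2_8_ii_part

/-- [node EtTh:Cor3.8(i) · L2/D1 · DAG status discharged(p460739)] discharge witness of `N_EtTh_Cor3_8_i` (indexed in `DAGL2s` with `_part` while the row was landed; now discharged, p460739): BY NAME; proves nothing new. -/
theorem N_EtTh_Cor3_8_i_holds : N_EtTh_Cor3_8_i := N_EtTh_Cor3_8_i_part

/-- [node EtTh:Cor3.8(i) · L2/D1 · DAG status discharged(p460739)] discharge witness of `N_EtTh_Cor3_8_i'` (indexed in `DAGXi` with `_part` while the row was landed; now discharged, p460739): BY NAME; proves nothing new. -/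
theorem N_EtTh_Cor3_8_i'_holds : N_EtTh_Cor3_8_i' := N_EtTh_Cor3_8_i'_part

/-- [node AbsTopIII:Cor4.5(ii) · L4/D1 · DAG status discharged(p428204)] discharge witness of `N_AbsTopIII_Cor4_5_ii` (indexed in `DAGL4s` with `_part` while the row was landed; now discharged, p428204): BY NAME; proves nothing new. -/
theorem N_AbsTopIII_Cor4_5_ii_holds : N_AbsTopIII_Cor4_5_ii := N_AbsTopIII_Cor4_5_ii_part

end Summit.ABC.IUTFork.DAG
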